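import Mathlib
import HarnessLib
import Literature.Dynamics.Hyperbolic.RGFlowStableManifoldSecondDiffIterate
import Literature.Dynamics.Hyperbolic.RGFlowStableManifoldSecondDiffSizes

/-!
# The second fixed point of the fine tuning ([ABKM19] Lemma 12.6), IV: uniqueness and LIPSCHITZ
# DEPENDENCE of the tuned initial relevant coordinate `h⋆` on the initial activity
# (regular dependence of `ℋ(𝒦)` on the perturbation `𝒦`, difference form)

Continuation of `RGFlowStableManifoldReducedLipschitz.lean` (§7, `exists_isTunedQ_initial_eq`: for a
system `(A^h, B^h, S^h, y₀^h)` indexed by the initial relevant coordinate `h ∈ E_0`, `‖h‖ ≤ ρ`, with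
SMALL Lipschitz constants of the data in `h`, there is `h⋆` with a tuned trajectory `x` of system `h⋆`
in the `ε`-tube and `x_0 = h⋆`).  In [ABKM19] the initial activity `y₀^h = K̂_0(𝒦, ℋ)` ALSO depends on
the perturbation `𝒦`, and Theorem 2.2 (smoothness of the free energy `𝒲_N` in `𝒦`) needs the regular
dependence of `h⋆ = ℋ(𝒦)` on `𝒦`.  In difference form (which is all the downstream estimates
consume) this is the comparison of the fixed points of two systems that share the steps
`(A^h, B^h, S^h)` and have initial activities `y₀^h`, `y₀'^h` with `‖y₀^h − y₀'^h‖_0 ≤ m_p` uniformly on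
the ball:

* **`RGFlow.norm_initial_sub_le_of_isTunedQ`** — if `h₁` carries a tuned trajectory of system
  `(A^{h₁}, B^{h₁}, S^{h₁}, y₀^{h₁})` in the `ε`-tube starting at `x_0 = h₁` (a fixed point of Lemma 12.6)
  and `h₂` likewise for `y₀'`, then `‖h₁ − h₂‖ ≤ 2 m_p/(1−κ)` — the contraction estimate
  `norm_sub_le_of_isTunedQ` run on the two tuned trajectories, whose data differ by
  `(a₀, b₀, l₀, m₀)·‖h₁ − h₂‖` (absorbed by the smallness (12.54)–(12.56)) plus `m_p`;
* **`RGFlow.initial_unique_of_isTunedQ`** — in particular (`m_p = 0`) the fixed point of Lemma 12.6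
  is UNIQUE, so `𝒦 ↦ ℋ(𝒦)` is a well-defined map;
* **`RGFlow.dist_traj_le_of_isTunedQ_initial`** — the two tuned trajectories then differ by at most
  `(2 m_p/(1−κ)) η^k` at scale `k`, in BOTH coordinates (for predicates closed from above, `hQc`).

Pure fixed-point bookkeeping over `RGFlowStableManifoldReducedLipschitz` /
`RGFlowStableManifoldSecondDiffIterate`; everything is proved, no named fact.  The second-order
version (bounded mixed second differences of `h⋆` in the perturbation) is the sequel
`RGFlowStableManifoldSecondFixedPointSecondDiff.lean`.

## References
* S. Adams, S. Buchholz, R. Kotecký, S. Müller, arXiv:1910.13564, Lemma 12.6 and its proof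
  (12.50)–(12.56), Theorem 12.1, Theorem 2.2 [AdamsBuchholzKoteckyMuller2019].
-/

noncomputable section

open Set Function Metric Filter
open scoped NNReal Topology

namespace Literature.Dynamics.Hyperbolic

namespace RGFlow

variable {E : ℕ → Type*} [∀ k, NormedAddCommGroup (E k)] [∀ k, NormedSpace ℝ (E k)]
  {F : ℕ → Type*} [∀ k, AddCommGroup (F k)]

/-! ## §12 Algebra of the first-order size -/

/-- `Δ(a, b, l, m + m') ≤ Δ(a, b, l, m) + m'` for `m' ≥ 0` (the initial-activity slot of `pertSize` is a
plain maximum). [cite: AdamsBuchholzKoteckyMuller2019, Ch. 12, eqs. (12.51)–(12.53)] -/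
theorem pertSize_add_le (α β η ε a b l m : ℝ) {m' : ℝ} (hm' : 0 ≤ m') :
    pertSize α β η ε a b l (m + m') ≤ pertSize α β η ε a b l m + m' := by
  unfold pertSize
  refine max_le ?_ ?_
  · linarith [le_max_left m (max (l * ε / η) ((α * b + a * (η + β + b)) * ε))]
  · linarith [le_max_right m (max (l * ε / η) ((α * b + a * (η + β + b)) * ε))]

/-- The first-order size of data differing by `(a₀t, b₀t, l₀t, m₀t)` with `0 ≤ t ≤ 2ρ` is at most
`t · max m₀ (max (l₀ε/η) ((αb₀ + a₀(η+β+2ρb₀))ε))` — the constant of the smallness condition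
(12.54)–(12.56). [cite: AdamsBuchholzKoteckyMuller2019, Lemma 12.6 (12.54)–(12.56)] -/
theorem pertSize_linear_le {α β η ε ρ a₀ b₀ l₀ m₀ t : ℝ} (ht : 0 ≤ t) (ht2 : t ≤ 2 * ρ)
    (ha0 : 0 ≤ a₀) (hb0 : 0 ≤ b₀) (hε : 0 ≤ ε) :
    pertSize α β η ε (a₀ * t) (b₀ * t) (l₀ * t) (m₀ * t)
      ≤ t * max m₀ (max (l₀ * ε / η) ((α * b₀ + a₀ * (η + β + 2 * ρ * b₀)) * ε)) := by
  rw [pertSize_linear ht]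
  refine mul_le_mul_of_nonneg_left (max_le_max le_rfl (max_le_max le_rfl ?_)) ht
  refine mul_le_mul_of_nonneg_right (add_le_add le_rfl ?_) hε
  refine mul_le_mul_of_nonneg_left (add_le_add le_rfl ?_) ha0
  calc b₀ * t ≤ b₀ * (2 * ρ) := mul_le_mul_of_nonneg_left ht2 hb0
    _ = 2 * ρ * b₀ := by ring

/-! ## §13 Comparison of two fixed points of Lemma 12.6 -/

section compareFixedPoints

variable {N : ℕ} {r α β σ η κ ε ρ a₀ b₀ l₀ m₀ mp : ℝ} {Q : ∀ k, F k → ℝ → Prop}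
  {A : E 0 → ∀ k, E k ≃L[ℝ] E (k + 1)} {B : E 0 → ∀ k, F k →+ E (k + 1)}
  {S : E 0 → ∀ k, E k → F k → F (k + 1)} {y₀ y₀' : E 0 → F 0}
  {h₁ h₂ : E 0} {x₁ x₂ : ∀ k, E k}

omit [∀ k, NormedSpace ℝ (E k)] in
/-- **The first-order size of the data difference between two fixed points.**  In the setting of
`exists_isTunedQ_initial_eq` (steps indexed by `h`, Lipschitz in `h` with constants `a₀, b₀, l₀, m₀`
satisfying the smallness (12.54)–(12.56)), for two initial coordinates `h₁, h₂` in the `ρ`-ball and two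
initial-activity maps with `‖y₀^h − y₀'^h‖_0 ≤ m_p` on the ball, the size of the perturbation between
the systems `(A^{h₁}, B^{h₁}, S^{h₁}, y₀^{h₁})` and `(A^{h₂}, B^{h₂}, S^{h₂}, y₀'^{h₂})`, divided by `1 − κ`, is
at most `‖h₁ − h₂‖/2 + m_p/(1−κ)`. [cite: AdamsBuchholzKoteckyMuller2019, Lemma 12.6 (12.54)–(12.56)] -/
theorem pertSize_div_le_of_small (hκ : κ < 1) (hε : 0 ≤ ε) (ha0 : 0 ≤ a₀) (hb0 : 0 ≤ b₀) (hmp : 0 ≤ mp)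
    (hsmall : max m₀ (max (l₀ * ε / η) ((α * b₀ + a₀ * (η + β + 2 * ρ * b₀)) * ε)) ≤ (1 - κ) / 2)
    (hh₁ : ‖h₁‖ ≤ ρ) (hh₂ : ‖h₂‖ ≤ ρ) :
    pertSize α β η ε (a₀ * ‖h₁ - h₂‖) (b₀ * ‖h₁ - h₂‖) (l₀ * ‖h₁ - h₂‖) (m₀ * ‖h₁ - h₂‖ + mp) / (1 - κ)
      ≤ ‖h₁ - h₂‖ / 2 + mp / (1 - κ) := by
  set t := ‖h₁ - h₂‖ with ht
  have ht0 : 0 ≤ t := norm_nonneg _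
  have ht2 : t ≤ 2 * ρ := by
    calc t ≤ ‖h₁‖ + ‖h₂‖ := norm_sub_le _ _
      _ ≤ ρ + ρ := add_le_add hh₁ hh₂
      _ = 2 * ρ := by ring
  have h1κ : 0 < 1 - κ := by linarith
  have hP : pertSize α β η ε (a₀ * t) (b₀ * t) (l₀ * t) (m₀ * t + mp) ≤ t * ((1 - κ) / 2) + mp := by
    calc pertSize α β η ε (a₀ * t) (b₀ * t) (l₀ * t) (m₀ * t + mp)
        ≤ pertSize α β η ε (a₀ * t) (b₀ * t) (l₀ * t) (m₀ * t) + mp := pertSize_add_le _ _ _ _ _ _ _ _ hmp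
      _ ≤ t * max m₀ (max (l₀ * ε / η) ((α * b₀ + a₀ * (η + β + 2 * ρ * b₀)) * ε)) + mp :=
          add_le_add (pertSize_linear_le ht0 ht2 ha0 hb0 hε) le_rfl
      _ ≤ t * ((1 - κ) / 2) + mp := add_le_add (mul_le_mul_of_nonneg_left hsmall ht0) le_rfl
  calc pertSize α β η ε (a₀ * t) (b₀ * t) (l₀ * t) (m₀ * t + mp) / (1 - κ)
      ≤ (t * ((1 - κ) / 2) + mp) / (1 - κ) := div_le_div_of_nonneg_right hP h1κ.le
    _ = t / 2 + mp / (1 - κ) := by field_simp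

/-- **Lipschitz dependence of the second fixed point on the initial activity** ([ABKM19] Lemma 12.6,
regular dependence of `ℋ(𝒦)` on `𝒦`, first order, difference form).  Steps `(A^h, B^h, S^h)` indexed
by `h ∈ E_0`, `‖h‖ ≤ ρ`, satisfying `IsRGStepQ N r α β σ Q` and Lipschitz in `h` with constants
`a₀, b₀, l₀` on the `r`-ball; two initial-activity maps `y₀, y₀'`, the first `m₀`-Lipschitz in `h`, with
`‖y₀^h − y₀'^h‖_0 ≤ m_p` on the ball; smallness
`max(m₀, l₀ε/η, (αb₀ + a₀(η+β+2ρb₀))ε) ≤ (1−κ)/2`, `ε ≤ r`, `ε ≤ ρ`.  If `x₁` is a tuned trajectory of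
system `(A^{h₁}, B^{h₁}, S^{h₁}, y₀^{h₁})` in the `ε`-tube with `x₁(0) = h₁`, and `x₂` one of
`(A^{h₂}, B^{h₂}, S^{h₂}, y₀'^{h₂})` in the `ε`-tube with `x₂(0) = h₂`, then `‖h₁ − h₂‖ ≤ 2 m_p/(1−κ)`.
[cite: AdamsBuchholzKoteckyMuller2019, Lemma 12.6] -/
theorem norm_initial_sub_le_of_isTunedQ (hQ : IsSubaddNormBound Q)
    (hT : ∀ h : E 0, ‖h‖ ≤ ρ → IsRGStepQ N r α β σ Q (A h) (B h) (S h))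
    (hη : 0 < η) (hη1 : η ≤ 1) (hα : 0 ≤ α) (hβ : 0 ≤ β) (hκ₁ : α * (η + β) ≤ κ) (hκ₂ : σ ≤ κ * η)
    (hκ : κ < 1) (hε : 0 ≤ ε) (hεr : ε ≤ r) (hερ : ε ≤ ρ) (ha0 : 0 ≤ a₀) (hb0 : 0 ≤ b₀) (hl0 : 0 ≤ l₀)
    (hmp : 0 ≤ mp)
    (ha : ∀ h h' : E 0, ‖h‖ ≤ ρ → ‖h'‖ ≤ ρ → ∀ k, k < N → ∀ w : E (k + 1),
      ‖(A h k).symm w - (A h' k).symm w‖ ≤ a₀ * ‖h - h'‖ * ‖w‖)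
    (hb : ∀ h h' : E 0, ‖h‖ ≤ ρ → ‖h'‖ ≤ ρ → ∀ k, k < N → ∀ (v : F k) (c : ℝ), Q k v c →
      ‖B h k v - B h' k v‖ ≤ b₀ * ‖h - h'‖ * c)
    (hl : ∀ h h' : E 0, ‖h‖ ≤ ρ → ‖h'‖ ≤ ρ → ∀ k, k < N → ∀ (u : E k) (v : F k) (c : ℝ),
      ‖u‖ ≤ r → Q k v c → c ≤ r → Q (k + 1) (S h k u v - S h' k u v) (l₀ * ‖h - h'‖ * max ‖u‖ c))
    (hm : ∀ h h' : E 0, ‖h‖ ≤ ρ → ‖h'‖ ≤ ρ → Q 0 (y₀ h - y₀ h') (m₀ * ‖h - h'‖))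
    (hmp' : ∀ h : E 0, ‖h‖ ≤ ρ → Q 0 (y₀ h - y₀' h) mp)
    (hsmall : max m₀ (max (l₀ * ε / η) ((α * b₀ + a₀ * (η + β + 2 * ρ * b₀)) * ε)) ≤ (1 - κ) / 2)
    (htr₁ : IsTunedQ N (A h₁) (B h₁) (S h₁) (y₀ h₁) x₁) (htu₁ : InTubeQ N η ε Q (S h₁) (y₀ h₁) x₁)
    (hx₁ : x₁ 0 = h₁)
    (htr₂ : IsTunedQ N (A h₂) (B h₂) (S h₂) (y₀' h₂) x₂) (htu₂ : InTubeQ N η ε Q (S h₂) (y₀' h₂) x₂)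
    (hx₂ : x₂ 0 = h₂) :
    ‖h₁ - h₂‖ ≤ 2 * mp / (1 - κ) := by
  have hh₁ : ‖h₁‖ ≤ ρ := by
    have h := (htu₁ 0 (Nat.zero_le _)).1
    rw [pow_zero, mul_one, hx₁] at h
    exact h.trans hερ
  have hh₂ : ‖h₂‖ ≤ ρ := by
    have h := (htu₂ 0 (Nat.zero_le _)).1
    rw [pow_zero, mul_one, hx₂] at h
    exact h.trans hερ
  set t := ‖h₁ - h₂‖ with ht
  have ht0 : 0 ≤ t := norm_nonneg _
  -- the initial activities differ by `m₀ t + mp`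
  have hm' : Q 0 (y₀ h₁ - y₀' h₂) (m₀ * t + mp) := by
    have e : y₀ h₁ - y₀' h₂ = (y₀ h₁ - y₀ h₂) + (y₀ h₂ - y₀' h₂) := by abel
    rw [e]
    exact hQ.add 0 _ _ _ _ (hm h₁ h₂ hh₁ hh₂) (hmp' h₂ hh₂)
  have hd := norm_sub_le_of_isTunedQ (a := a₀ * t) (b := b₀ * t) (l := l₀ * t) (m := m₀ * t + mp)
    hQ (hT h₁ hh₁) hη hη1 hα hβ hκ₁ hκ₂ hκ hε hεr htr₁ htr₂ htu₁ htu₂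
    (mul_nonneg ha0 ht0) (mul_nonneg hl0 ht0)
    (fun k hk w => ha h₁ h₂ hh₁ hh₂ k hk w) (fun k hk v c hv => hb h₁ h₂ hh₁ hh₂ k hk v c hv)
    (fun k hk u v c hu hv hc => hl h₁ h₂ hh₁ hh₂ k hk u v c hu hv hc) hm'
  have h0 := hd 0 (Nat.zero_le _)
  rw [pow_zero, mul_one, hx₁, hx₂] at h0
  have h1 := h0.trans (pertSize_div_le_of_small hκ hε ha0 hb0 hmp hsmall hh₁ hh₂)
  -- `t ≤ t/2 + mp/(1-κ)`
  have h1κ : 0 < 1 - κ := by linarith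
  rw [← ht] at h1
  have : t ≤ 2 * (mp / (1 - κ)) := by linarith
  calc t ≤ 2 * (mp / (1 - κ)) := this
    _ = 2 * mp / (1 - κ) := by ring

/-- **Uniqueness of the second fixed point** ([ABKM19] Lemma 12.6): under the smallness condition, two
initial coordinates `h₁, h₂` each carrying a tuned trajectory of its own system `(A^h, B^h, S^h, y₀^h)` in
the `ε`-tube with `x(0) = h` coincide.  Hence `𝒦 ↦ ℋ(𝒦)` is a well-defined map.
[cite: AdamsBuchholzKoteckyMuller2019, Lemma 12.6] -/
theorem initial_unique_of_isTunedQ (hQ : IsSubaddNormBound Q)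
    (hT : ∀ h : E 0, ‖h‖ ≤ ρ → IsRGStepQ N r α β σ Q (A h) (B h) (S h))
    (hη : 0 < η) (hη1 : η ≤ 1) (hα : 0 ≤ α) (hβ : 0 ≤ β) (hκ₁ : α * (η + β) ≤ κ) (hκ₂ : σ ≤ κ * η)
    (hκ : κ < 1) (hε : 0 ≤ ε) (hεr : ε ≤ r) (hερ : ε ≤ ρ) (ha0 : 0 ≤ a₀) (hb0 : 0 ≤ b₀) (hl0 : 0 ≤ l₀)
    (ha : ∀ h h' : E 0, ‖h‖ ≤ ρ → ‖h'‖ ≤ ρ → ∀ k, k < N → ∀ w : E (k + 1),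
      ‖(A h k).symm w - (A h' k).symm w‖ ≤ a₀ * ‖h - h'‖ * ‖w‖)
    (hb : ∀ h h' : E 0, ‖h‖ ≤ ρ → ‖h'‖ ≤ ρ → ∀ k, k < N → ∀ (v : F k) (c : ℝ), Q k v c →
      ‖B h k v - B h' k v‖ ≤ b₀ * ‖h - h'‖ * c)
    (hl : ∀ h h' : E 0, ‖h‖ ≤ ρ → ‖h'‖ ≤ ρ → ∀ k, k < N → ∀ (u : E k) (v : F k) (c : ℝ),
      ‖u‖ ≤ r → Q k v c → c ≤ r → Q (k + 1) (S h k u v - S h' k u v) (l₀ * ‖h - h'‖ * max ‖u‖ c))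
    (hm : ∀ h h' : E 0, ‖h‖ ≤ ρ → ‖h'‖ ≤ ρ → Q 0 (y₀ h - y₀ h') (m₀ * ‖h - h'‖))
    (hsmall : max m₀ (max (l₀ * ε / η) ((α * b₀ + a₀ * (η + β + 2 * ρ * b₀)) * ε)) ≤ (1 - κ) / 2)
    (htr₁ : IsTunedQ N (A h₁) (B h₁) (S h₁) (y₀ h₁) x₁) (htu₁ : InTubeQ N η ε Q (S h₁) (y₀ h₁) x₁)
    (hx₁ : x₁ 0 = h₁)
    (htr₂ : IsTunedQ N (A h₂) (B h₂) (S h₂) (y₀ h₂) x₂) (htu₂ : InTubeQ N η ε Q (S h₂) (y₀ h₂) x₂)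
    (hx₂ : x₂ 0 = h₂) :
    h₁ = h₂ := by
  have hmp' : ∀ h : E 0, ‖h‖ ≤ ρ → Q 0 (y₀ h - y₀ h) 0 := fun h _ => by
    rw [sub_self]; exact hQ.zero 0
  have h := norm_initial_sub_le_of_isTunedQ hQ hT hη hη1 hα hβ hκ₁ hκ₂ hκ hε hεr hερ ha0 hb0 hl0 le_rfl
    ha hb hl hm hmp' hsmall htr₁ htu₁ hx₁ htr₂ htu₂ hx₂
  rw [mul_zero, zero_div] at h
  exact sub_eq_zero.1 (norm_le_zero_iff.1 h)

/-- **The tuned trajectories of two fixed points are `(2m_p/(1−κ))η^k`-close in both coordinates**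
([ABKM19] Lemma 12.6 with Theorem 12.1, continuity content, difference form): in the setting of
`norm_initial_sub_le_of_isTunedQ`, for predicates closed from above in the bound (`hQc`), for every
`k ≤ N`: `‖x₁(k) − x₂(k)‖ ≤ (2m_p/(1−κ)) η^k` and `‖y₁(k) − y₂(k)‖_k ≤ (2m_p/(1−κ)) η^k`.
[cite: AdamsBuchholzKoteckyMuller2019, Lemma 12.6, Theorem 12.1] -/
theorem dist_traj_le_of_isTunedQ_initial (hQ : IsSubaddNormBound Q)
    (hQc : ∀ k (y : F k) (c : ℝ), (∀ c', c < c' → Q k y c') → Q k y c)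
    (hT : ∀ h : E 0, ‖h‖ ≤ ρ → IsRGStepQ N r α β σ Q (A h) (B h) (S h))
    (hη : 0 < η) (hη1 : η ≤ 1) (hα : 0 ≤ α) (hβ : 0 ≤ β) (hκ₁ : α * (η + β) ≤ κ) (hκ₂ : σ ≤ κ * η)
    (hκ : κ < 1) (hε : 0 ≤ ε) (hεr : ε ≤ r) (hερ : ε ≤ ρ) (ha0 : 0 ≤ a₀) (hb0 : 0 ≤ b₀) (hl0 : 0 ≤ l₀)
    (hmp : 0 ≤ mp)
    (ha : ∀ h h' : E 0, ‖h‖ ≤ ρ → ‖h'‖ ≤ ρ → ∀ k, k < N → ∀ w : E (k + 1),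
      ‖(A h k).symm w - (A h' k).symm w‖ ≤ a₀ * ‖h - h'‖ * ‖w‖)
    (hb : ∀ h h' : E 0, ‖h‖ ≤ ρ → ‖h'‖ ≤ ρ → ∀ k, k < N → ∀ (v : F k) (c : ℝ), Q k v c →
      ‖B h k v - B h' k v‖ ≤ b₀ * ‖h - h'‖ * c)
    (hl : ∀ h h' : E 0, ‖h‖ ≤ ρ → ‖h'‖ ≤ ρ → ∀ k, k < N → ∀ (u : E k) (v : F k) (c : ℝ),
      ‖u‖ ≤ r → Q k v c → c ≤ r → Q (k + 1) (S h k u v - S h' k u v) (l₀ * ‖h - h'‖ * max ‖u‖ c))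
    (hm : ∀ h h' : E 0, ‖h‖ ≤ ρ → ‖h'‖ ≤ ρ → Q 0 (y₀ h - y₀ h') (m₀ * ‖h - h'‖))
    (hmp' : ∀ h : E 0, ‖h‖ ≤ ρ → Q 0 (y₀ h - y₀' h) mp)
    (hsmall : max m₀ (max (l₀ * ε / η) ((α * b₀ + a₀ * (η + β + 2 * ρ * b₀)) * ε)) ≤ (1 - κ) / 2)
    (htr₁ : IsTunedQ N (A h₁) (B h₁) (S h₁) (y₀ h₁) x₁) (htu₁ : InTubeQ N η ε Q (S h₁) (y₀ h₁) x₁)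
    (hx₁ : x₁ 0 = h₁)
    (htr₂ : IsTunedQ N (A h₂) (B h₂) (S h₂) (y₀' h₂) x₂) (htu₂ : InTubeQ N η ε Q (S h₂) (y₀' h₂) x₂)
    (hx₂ : x₂ 0 = h₂) :
    ∀ k, k ≤ N → ‖x₁ k - x₂ k‖ ≤ 2 * mp / (1 - κ) * η ^ k ∧
      Q k (fwd (S h₁) (y₀ h₁) x₁ k - fwd (S h₂) (y₀' h₂) x₂ k) (2 * mp / (1 - κ) * η ^ k) := by
  have hh₁ : ‖h₁‖ ≤ ρ := by
    have h := (htu₁ 0 (Nat.zero_le _)).1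
    rw [pow_zero, mul_one, hx₁] at h
    exact h.trans hερ
  have hh₂ : ‖h₂‖ ≤ ρ := by
    have h := (htu₂ 0 (Nat.zero_le _)).1
    rw [pow_zero, mul_one, hx₂] at h
    exact h.trans hερ
  set t := ‖h₁ - h₂‖ with ht
  have ht0 : 0 ≤ t := norm_nonneg _
  have hm' : Q 0 (y₀ h₁ - y₀' h₂) (m₀ * t + mp) := by
    have e : y₀ h₁ - y₀' h₂ = (y₀ h₁ - y₀ h₂) + (y₀ h₂ - y₀' h₂) := by abel
    rw [e]
    exact hQ.add 0 _ _ _ _ (hm h₁ h₂ hh₁ hh₂) (hmp' h₂ hh₂)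
  have hd := distQ_le_of_isTunedQ (a := a₀ * t) (b := b₀ * t) (l := l₀ * t) (m := m₀ * t + mp)
    hQ hQc (hT h₁ hh₁) hη hη1 hα hβ hκ₁ hκ₂ hκ hε hεr htr₁ htr₂ htu₁ htu₂
    (mul_nonneg ha0 ht0) (mul_nonneg hl0 ht0)
    (fun k hk w => ha h₁ h₂ hh₁ hh₂ k hk w) (fun k hk v c hv => hb h₁ h₂ hh₁ hh₂ k hk v c hv)
    (fun k hk u v c hu hv hc => hl h₁ h₂ hh₁ hh₂ k hk u v c hu hv hc) hm'
  -- the weighted distance is at most `t/2 + mp/(1-κ) ≤ 2mp/(1-κ)`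
  have hP := pertSize_div_le_of_small (α := α) (β := β) (η := η) (l₀ := l₀) (m₀ := m₀)
    hκ hε ha0 hb0 hmp hsmall hh₁ hh₂
  have htb : t ≤ 2 * mp / (1 - κ) := norm_initial_sub_le_of_isTunedQ hQ hT hη hη1 hα hβ hκ₁ hκ₂ hκ hε
    hεr hερ ha0 hb0 hl0 hmp ha hb hl hm hmp' hsmall htr₁ htu₁ hx₁ htr₂ htu₂ hx₂
  have h1κ : 0 < 1 - κ := by linarith
  have hD : pertSize α β η ε (a₀ * t) (b₀ * t) (l₀ * t) (m₀ * t + mp) / (1 - κ) ≤ 2 * mp / (1 - κ) := by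
    refine hP.trans ?_
    have e : 2 * mp / (1 - κ) = (2 * mp / (1 - κ)) / 2 + mp / (1 - κ) := by field_simp; ring
    rw [e]
    linarith
  intro k hk
  obtain ⟨h1, h2⟩ := hd k hk
  have hηk : 0 ≤ η ^ k := pow_nonneg hη.le k
  exact ⟨h1.trans (mul_le_mul_of_nonneg_right hD hηk), hQ.mono _ _ _ _ h2 (mul_le_mul_of_nonneg_right hD hηk)⟩

end compareFixedPoints

end RGFlow

end Literature.Dynamics.Hyperbolic

end
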